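import Summits.HodgeConjecture.HodgeConjecture.Theorems.Ring2AbelianAllOneSplitWeilAnchorQuadraticField
import Summits.HodgeConjecture.HodgeConjecture.Theorems.Ring2AbelianAllOneSplitWeilAnchorMarkman
import Summits.HodgeConjecture.HodgeConjecture.Theorems.VHCAbelianSchemesRoadSecantQuotientAnchorPinnedPrimeMarkman
import Summits.HodgeConjecture.HodgeConjecture.Theorems.VHCAbelianSchemesRoadTwistedDoor
import Summits.HodgeConjecture.HodgeConjecture.Theses.VHCAbelianSchemesRoad
import Literature.AlgebraicGeometry.HodgeTheory.TwistedPerfectAdmissibilityInitialSegment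
import HarnessLib

/-!
# Ring 2 / AbelianAll (André column) READ AT THE ROUTE'S PRIMED DOOR `TwistedPerfectDoorPrime` (rev 22): the per-field `(6,3)` cell SERVED VERBATIM by
# print's pinned claim L1″ at ANY admissibility; the transfer-free `(6,3)` split sector; `AndreSplitWeilClasses`, `HC_CM` and `HC_AV` (with `HC_CM` idle)
# from the field-wise one-anchor node at `twistedReflexiveClass C AdmTw′` — the André column's `B_min` of gen 64 (leaf file)

research route, not a corollary; conditional on HC_CM plus one named minimal statement.

LEAF FILE (imports the route file; nothing should import it). THEOREMS ONLY (no definition, no new named fact; print's claim-tagged L1″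
`HodgeTheory.Markman2025_secantQuotient_twistedCarrier_onJacobian_pinned C Adm` — PREPRINT arXiv:2502.03415, under review — enters as a HYPOTHESIS by name; the
route's binders `ChernCharacterOnBetti` (19780), `TwistedPerfectDoorPrime` (20706), `AndreCMAnchoredPencil` (19783) by name; `HC_CM` only as a CONCLUSION). PART AG.
Director-hodge R10.1 (S3): the André column continues on the per-field re-typing of the quadratic cell, citing lane W1's (S2) decls by name. The route was re-keyed
(rev 22, director R9.4) to the PRIMED twisted door `twistedReflexiveClass C AdmTw′`, `AdmTw′ := gluableSigmaAdmissible ∨ bfSingleAdmissible′`; PART AF's rows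
were keyed to the door of item 19275 (`AdmTw`, now aside). This file reads the column at the primed door through the `𝒪`-generic nodes of Defs §3:

* §1 **THE PER-FIELD `(6,3)` CELL IS PRINT'S PINNED CLAIM READ VERBATIM, at every admissibility `Adm`**:
  `L1″(C, Adm) ⟹ QuadraticFieldSplitSixfoldAnchorOneCarrier (twistedReflexiveClass C Adm)` — for every `r ≥ 1` the anchor is Markman's secant quotient at level
  `d = 4r` (`ψ_Y² = −(4r+1)²·4r = −(2(4r+1))²·r`: generator in the order `ℤ[2(4r+1)√−r]` of `ℚ(√−r)`; PART AF §3 `oneSplitWeilAnchorCarriers_of_markmanPinned`). In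
  particular at the PRIMED door (`Adm := AdmTw′`), and — by lane W1's door monotonicity `markmanPinned_admTw_of_admTw'` (ring2-b03x g2, BY NAME) or by the cell's own
  monotonicity — at the door of record `AdmTw`.
* §2 **THE TRANSFER-FREE `(6,3)` SPLIT SECTOR AT THE PRIMED DOOR**: K-C ∧ `TwistedPerfectDoorPrime` ∧ the family fact `andre1996_weilLineFamily_throughSplitAnchor` ∧
  `(∀ C, L1″(C, AdmTw′))` ⟹ `W(B) ⊗ ℂ ≤ algebraicClasses B.X 3` for EVERY split Weil sixfold `(B, η, e, a)`, every imaginary quadratic type `T + r` (in print: Markman's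
  Thm. 1.5.1 on the split components). COMPARE lane W1's stub 2a‴ of the deciding crux 20707, which reads `2a‴ = L1″(AdmTw′) ∧ TRANSFER` (the node
  `SecantQuotientWeilDirectionTransfer63PinnedPrime`: every pinned-served rational Weil direction at every pinned anchor — gaps (G1)∕(G3), not in print): the André
  format needs ONE direction at ONE anchor per field and NO transfer node, the price being the family-through-a-prescribed-anchor fact (Deligne's construction, a
  statement-only Literature fact) in place of the road's pencil supply. Neither lane waits on the other.
* §3 **THE COLUMN AT THE PRIMED DOOR**: `AndreSplitWeilClasses`, `HC_CM` (+ Kodaira; Lemme 6.3.2 = CorCM kernel theorem) and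
  **`HC_AV ⟸ K-C ∧ TwistedPerfectDoorPrime ∧ Kodaira ∧ AndreCMAnchoredPencil ∧ the family fact ∧ (∀ C, CMAlgebraicCarriers (tw C AdmTw′)) ∧
  (∀ C, OneSplitWeilAnchorFieldChartCarriersAll (tw C AdmTw′))`** — THE ANDRÉ COLUMN'S `B_min` OF GEN 64 (`HC_CM` IDLE; quadratic types PER FIELD; primed door).
* §4 HONEST BOOKKEEPING of what the primed door moves: the primed carrier nodes are the STRONGER ones (`tw C AdmTw′ ⊆ tw C AdmTw`: node′ ⟹ node), the primed door the
  WEAKER one (`TwistedPerfectDoor ⟹ TwistedPerfectDoorPrime`, `TwistedPerfectDoorVHC.anti`); neither converse is claimed.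

HONEST: L1″ is an UNREFEREED preprint claim; every carrier node is OPEN and NOT implied by the Hodge conjecture; the family fact, Kodaira and Lemme 6.3.1 are theorems
in print entering BY NAME (the family fact statement-only in the tree). Nothing here says L1″, any node, either door, any Weil class, `HC_CM`, `HC_AV` or HC holds.
References: [cite: Markman2025SecantWeil, §1.5 (p. 7), Thm. 1.4.1, Thm. 1.5.1, §9.3 Remark 9.3.7 and Lemma 9.3.11] [cite: Andre1996Motifs, §6.3 a)–c), Lemmes 6.3.1–6.3.3 (pp. 31–33)]
[cite: Andre1992HodgeCM, Théorème] [cite: Deligne1982HodgeCycles, §4 proof of Thm. 4.8 (clauses (a)–(c))] [cite: vanGeemen1994HodgeAV, 4.9] [cite: BuchweitzFlenner2003, §5 Thm. 5.1]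
[cite: Pridham2024Semiregularity, Cor. 2.25 and Rem. 2.26–2.27] [cite: Bloch1972Semiregularity, Remark (7.5)] [cite: Huybrechts2005, Prop. 5.3.1, Cor. 5.3.3] [cite: Milne1999, §7 p. 72].
-/

noncomputable section

open CategoryTheory CategoryTheory.Limits AlgebraicGeometry Topology

namespace Summit.HodgeConjecture.HodgeConjecture.Ring2.AbelianAll

-- the cell's namespace repeats the summit name (`Summit.HodgeConjecture.HodgeConjecture…`), as in every `Ring2*` file
set_option linter.dupNamespace false

open Literature.AlgebraicGeometry Literature.AlgebraicGeometry.Motives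
open Literature.AlgebraicGeometry.HodgeTheory Literature.AlgebraicGeometry.Markman2025
open Literature.AlgebraicGeometry.Deligne1982
open Literature.AlgebraicGeometry.VanGeemen1994 (pullbackOne)
open Literature.AlgebraicTopology.SingularHomology
open Literature.AlgebraicGeometry.Andre1996 (andre1996_cmAnchoredPencil andre1996_weilLineFamily_throughSplitAnchor)
open Summit.Ventures.HSemireg (ObjClass LocalVariationalHodgeFor gluableSigmaAdmissible)
open Summit.HodgeConjecture.HodgeConjecture.Theses
open Summit.HodgeConjecture.HodgeConjecture.Ring2.SemiregularRepresentatives (twistedPerfectDoorVHC_iff_localVariationalHodgeFor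
  oneSplitWeilAnchorCarriers_of_markmanPinned sq_two_mul_mul_eq markmanPinned_mono_door markmanPinned_admTw_of_admTw')

variable {C : ChernCharacterBetti} {Adm : PerfectAdmissibility} {r : ℕ}

/-! ## §1 The per-field `(6,3)` cell is print's pinned claim L1″ read verbatim — at every admissibility, hence at the primed door -/

/-- **L1″(C, Adm) ⟹ the per-field node of `ℚ(√−r)` at `p = 3` for the door `twistedReflexiveClass C Adm`, every `r ≥ 1`**: Markman's secant quotient at level `d = 4r`
is a one-class split anchor of type `T + (4r+1)²·4r = T + (2(4r+1))²·r` (PART AF §3), i.e. an anchor with multiplication by the order `ℤ[2(4r+1)√−r]` of `ℚ(√−r)` —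
exactly what the per-field node asks (`m = 2(4r+1)`). [claim: Markman2025SecantWeil, status: under-review] [cite: Markman2025SecantWeil, §1.5 (p. 7), Thm. 1.4.1 and Lemma 9.3.11]
[cite: vanGeemen1994HodgeAV, 4.9] [cite: Bloch1972Semiregularity, Remark (7.5)] -/
theorem quadraticFieldOneSplitWeilAnchorChartCarriers_three_of_markmanPinned (hM : Markman2025_secantQuotient_twistedCarrier_onJacobian_pinned C Adm)
    (hr : 0 < r) : QuadraticFieldOneSplitWeilAnchorChartCarriers (twistedReflexiveClass C Adm) r 3 := by
  have hd : Even (4 * r) := ⟨2 * r, by ring⟩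
  have h4 : 4 ≤ 4 * r := by omega
  -- the typed `∃∀` node at Markman's type `T + (4r+1)²·4r` (PART AF §3), as the per-field node of `ℚ(√−(4r+1)²·4r)` …
  have hQ := quadraticFieldOneSplitWeilAnchorChartCarriers_of_oneSplitWeilAnchorCarriers (oneSplitWeilAnchorCarriers_of_markmanPinned hM hd h4)
  -- … `= ℚ(√−r)`: `(4r+1)²·4r = (2(4r+1))²·r`, field invariance down
  rw [← sq_two_mul_mul_eq] at hQ
  exact hQ.of_mul_sq (by omega : 0 < 2 * (4 * r + 1))

/-- **THE PER-FIELD `(6,3)` CELL SERVED VERBATIM: `L1″(C, Adm) ⟹ QuadraticFieldSplitSixfoldAnchorOneCarrier (twistedReflexiveClass C Adm)`**, every Chern character theory `C`,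
EVERY admissibility notion `Adm`. Nothing here says L1″ holds. [claim: Markman2025SecantWeil, status: under-review] [cite: Markman2025SecantWeil, Thm. 1.4.1, §1.5 and Lemma 9.3.11]
[cite: Bloch1972Semiregularity, Remark (7.5)] -/
theorem quadraticFieldSplitSixfoldAnchorOneCarrier_of_markmanPinned (hM : Markman2025_secantQuotient_twistedCarrier_onJacobian_pinned C Adm) :
    QuadraticFieldSplitSixfoldAnchorOneCarrier (twistedReflexiveClass C Adm) :=
  fun _ hr ↦ quadraticFieldOneSplitWeilAnchorChartCarriers_three_of_markmanPinned hM hr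

/-- **At the route's PRIMED door**: `L1″(C, AdmTw′) ⟹ QuadraticFieldSplitSixfoldAnchorOneCarrier (twistedReflexiveClass C AdmTw′)` — the `(ℚ(√−r), p = 3)` conjuncts of the
André column's carrier input at rev 22 are PREPRINT-SERVED, every `r`. [claim: Markman2025SecantWeil, status: under-review] [cite: Markman2025SecantWeil, Thm. 1.4.1 and §9.3 Lemma 9.3.11]
[cite: BuchweitzFlenner2003, §5 Thm. 5.1] -/
theorem quadraticFieldSplitSixfoldAnchorOneCarrier_admTw'_of_markmanPinnedPrime
    (hM : Markman2025_secantQuotient_twistedCarrier_onJacobian_pinned C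
      (fun n X₀ I E => gluableSigmaAdmissible n X₀ I E ∨ bfSingleAdmissible' n X₀ I E)) :
    QuadraticFieldSplitSixfoldAnchorOneCarrier (twistedReflexiveClass C (fun n X₀ I E => gluableSigmaAdmissible n X₀ I E ∨ bfSingleAdmissible' n X₀ I E)) :=
  quadraticFieldSplitSixfoldAnchorOneCarrier_of_markmanPinned hM

/-- **… and at the door of record `AdmTw`, from L1″ at the PRIMED door** — through lane W1's edge `markmanPinned_admTw_of_admTw'` (ring2-b03x g2, by name): the primed reading
of print's claim serves the unprimed cell too. [claim: Markman2025SecantWeil, status: under-review] [cite: Markman2025SecantWeil, §9.3 Remark 9.3.7 and Lemma 9.3.11]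
[cite: Pridham2024Semiregularity, Cor. 2.25 and Rem. 2.26] -/
theorem quadraticFieldSplitSixfoldAnchorOneCarrier_admTw_of_markmanPinnedPrime
    (hM : Markman2025_secantQuotient_twistedCarrier_onJacobian_pinned C
      (fun n X₀ I E => gluableSigmaAdmissible n X₀ I E ∨ bfSingleAdmissible' n X₀ I E)) :
    QuadraticFieldSplitSixfoldAnchorOneCarrier (twistedReflexiveClass C (fun n X₀ I E => gluableSigmaAdmissible n X₀ I E ∨ bfSingleAdmissible n X₀ I E)) :=
  quadraticFieldSplitSixfoldAnchorOneCarrier_of_markmanPinned (markmanPinned_admTw_of_admTw' hM)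

/-! ## §2 The transfer-free `(6,3)` split sector at the primed door -/

section SplitSector

variable {B : AbelianVariety ℂ} {η : B ⟶ B} {e : ProjectiveEmbedding B.X} {a : complexBetti (projectiveSpace e.n ℂ) 2}

/-- The primed door binder, read as the venture's local variational Hodge statement for `twistedReflexiveClass C AdmTw′` (definitional). [cite: BuchweitzFlenner2003, §5 Thm. 5.1 (binder shape)] -/
theorem localVariationalHodgeFor_admTw'_of_twistedPerfectDoorPrime (hDoor : VHCAbelianSchemesRoad.TwistedPerfectDoorPrime) (C : ChernCharacterBetti) :
    LocalVariationalHodgeFor (twistedReflexiveClass C (fun n X₀ I E => gluableSigmaAdmissible n X₀ I E ∨ bfSingleAdmissible' n X₀ I E)) :=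
  (twistedPerfectDoorVHC_iff_localVariationalHodgeFor (C := C) (Adm := _)).1 (hDoor C)

/-- **THE `(6,3)` SPLIT SECTOR AT THE PRIMED DOOR, door-generic in `Adm` first**: the door for `twistedReflexiveClass C Adm` ∧ the family fact ∧ L1″(C, Adm) ⟹
`W(B) ⊗ ℂ ≤ algebraicClasses B.X 3` for EVERY split `ℚ(√−r)`-Weil sixfold datum `(B, η, e, a)` of type `(T + r, 1, 3)` — the per-field cell (§1) fed to the per-field row
(`Ring2AbelianAllOneSplitWeilAnchorQuadraticField` §3). No transfer node, no pencil supply. [claim: Markman2025SecantWeil, status: under-review]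
[cite: Markman2025SecantWeil, Thm. 1.4.1, §1.5 and Thm. 1.5.1] [cite: Andre1996Motifs, proof of Lemme 6.3.3 (p. 33)] [cite: Deligne1982HodgeCycles, §4 proof of Thm. 4.8] -/
theorem weilClassesField_le_algebraicClasses_quadraticSplitSixfold_of_door_of_throughSplitAnchor_of_markmanPinned
    (hT : LocalVariationalHodgeFor (twistedReflexiveClass C Adm)) (h : andre1996_weilLineFamily_throughSplitAnchor)
    (hM : Markman2025_secantQuotient_twistedCarrier_onJacobian_pinned C Adm) (hB : IsWeilTypeCM B η (Polynomial.X + Polynomial.C (r : ℤ)) 1 3)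
    (ha : IsRationalClass a) (ha₀ : a ≠ 0)
    (hRos : ∀ x y : complexBetti B.X 1,
      polarizationPairingOne B.X (complexBetti.map e.ι 2 a) (B.dim - 1) (pullbackOne B η x) y =
        -polarizationPairingOne B.X (complexBetti.map e.ι 2 a) (B.dim - 1) x (pullbackOne B η y))
    (hsplit : IsHyperbolicWeilType B η (3 * 1) (complexBetti.map e.ι 2 a)) :
    weilClassesField B η ((Polynomial.X + Polynomial.C (r : ℤ)).comp (Polynomial.X ^ 2)) (2 * 3) ≤ algebraicClasses B.X 3 :=
  weilClassesField_le_algebraicClasses_splitSixfold_of_door_of_quadraticFieldCell h hT (quadraticFieldSplitSixfoldAnchorOneCarrier_of_markmanPinned hM) hB ha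
    ha₀ hRos hsplit

/-- **ROAD-BINDER FORM AT REV 22: K-C ∧ `TwistedPerfectDoorPrime` ∧ the family fact ∧ `(∀ C, L1″(C, AdmTw′))` ⟹ the codimension-3 Weil classes of EVERY split Weil SIXFOLD
with imaginary-quadratic multiplication are algebraic** (every type `(T + r, 1, 3)`). TRANSFER-FREE: lane W1's stub 2a‴ of crux 20707 reads `L1″(AdmTw′) ∧ transfer`
(`secantQuotientAnchorCarrier63PinnedPrime_of_pinned_of_weilDirectionTransfer`, ring2-b03x g2); in the André format ONE direction at ONE anchor per field suffices, at
the price of the family-through-a-prescribed-anchor fact. Nothing here says L1″, the door or the family fact holds. [claim: Markman2025SecantWeil, status: under-review]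
[cite: Markman2025SecantWeil, Thm. 1.4.1 and Thm. 1.5.1] [cite: Andre1996Motifs, proof of Lemme 6.3.3 (p. 33)] [cite: Deligne1982HodgeCycles, §4 proof of Thm. 4.8]
[cite: BuchweitzFlenner2003, §5 Thm. 5.1] [cite: Pridham2024Semiregularity, Cor. 2.25 and Rem. 2.26–2.27] -/
theorem weilClassesField_le_algebraicClasses_quadraticSplitSixfold_of_markmanPinnedPrime_of_twistedPerfectDoorPrime
    (hC : VHCAbelianSchemesRoad.ChernCharacterOnBetti) (hDoor : VHCAbelianSchemesRoad.TwistedPerfectDoorPrime) (h : andre1996_weilLineFamily_throughSplitAnchor)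
    (hM : ∀ C : ChernCharacterBetti, Markman2025_secantQuotient_twistedCarrier_onJacobian_pinned C
      (fun n X₀ I E => gluableSigmaAdmissible n X₀ I E ∨ bfSingleAdmissible' n X₀ I E))
    (hB : IsWeilTypeCM B η (Polynomial.X + Polynomial.C (r : ℤ)) 1 3) (ha : IsRationalClass a) (ha₀ : a ≠ 0)
    (hRos : ∀ x y : complexBetti B.X 1,
      polarizationPairingOne B.X (complexBetti.map e.ι 2 a) (B.dim - 1) (pullbackOne B η x) y =
        -polarizationPairingOne B.X (complexBetti.map e.ι 2 a) (B.dim - 1) x (pullbackOne B η y))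
    (hsplit : IsHyperbolicWeilType B η (3 * 1) (complexBetti.map e.ι 2 a)) :
    weilClassesField B η ((Polynomial.X + Polynomial.C (r : ℤ)).comp (Polynomial.X ^ 2)) (2 * 3) ≤ algebraicClasses B.X 3 := by
  obtain ⟨C⟩ := (hC : Nonempty ChernCharacterBetti)
  exact weilClassesField_le_algebraicClasses_quadraticSplitSixfold_of_door_of_throughSplitAnchor_of_markmanPinned
    (localVariationalHodgeFor_admTw'_of_twistedPerfectDoorPrime hDoor C) h (hM C) hB ha ha₀ hRos hsplit

end SplitSector

/-! ## §3 The André column at the primed door: `AndreSplitWeilClasses`, `HC_CM`, `HC_AV` — `B_min` of gen 64 -/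

/-- **`AndreSplitWeilClasses ⟸ K-C ∧ TwistedPerfectDoorPrime ∧ the family fact ∧ (∀ C, OneSplitWeilAnchorFieldChartCarriersAll (tw C AdmTw′))`**: the Weil classes of the split
`E`-Weil structures of EVERY CM field, every `p ≥ 1`, from ONE `AdmTw′`-admissible twisted carrier of SOME class at every chart of ONE split anchor of our choice per
inhabited type — PER FIELD for imaginary quadratic `E`. NO CM hypothesis; `HC_CM` absent. [cite: Andre1996Motifs, §6.3 b)–c) (pp. 32–33)]
[cite: Deligne1982HodgeCycles, §4 proof of Thm. 4.8] [cite: vanGeemen1994HodgeAV, 4.9] [cite: BuchweitzFlenner2003, §5 Thm. 5.1] [cite: Pridham2024Semiregularity, Cor. 2.25 and Rem. 2.26–2.27] -/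
theorem andreSplitWeilClasses_of_twistedPerfectDoorPrime_of_throughSplitAnchor_of_fieldChartCarriersAll (hC : VHCAbelianSchemesRoad.ChernCharacterOnBetti)
    (hDoor : VHCAbelianSchemesRoad.TwistedPerfectDoorPrime) (h : andre1996_weilLineFamily_throughSplitAnchor)
    (hall : ∀ C : ChernCharacterBetti, OneSplitWeilAnchorFieldChartCarriersAll
      (twistedReflexiveClass C (fun n X₀ I E => gluableSigmaAdmissible n X₀ I E ∨ bfSingleAdmissible' n X₀ I E))) :
    AndreSplitWeilClasses := by
  obtain ⟨C⟩ := (hC : Nonempty ChernCharacterBetti)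
  exact andreSplitWeilClasses_of_throughSplitAnchor_of_door_of_oneSplitWeilAnchorFieldChartCarriersAll h
    (localVariationalHodgeFor_admTw'_of_twistedPerfectDoorPrime hDoor C) (hall C)

/-- **`HC_CM ⟸ K-C ∧ TwistedPerfectDoorPrime ∧ Kodaira ∧ the family fact ∧ (∀ C, OneSplitWeilAnchorFieldChartCarriersAll (tw C AdmTw′))`** (Lemme 6.3.2 = André 1992 is CorCM's
KERNEL theorem; Kodaira turns its polarization classes into hyperplane classes). [cite: Andre1996Motifs, §6.3 Lemmes 6.3.2–6.3.3 (pp. 32–33)] [cite: Andre1992HodgeCM, Théorème]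
[cite: Huybrechts2005, Prop. 5.3.1, Cor. 5.3.3] [cite: Pridham2024Semiregularity, Cor. 2.25 and Rem. 2.26–2.27] [cite: Milne1999, §7 p. 72] -/
theorem HC_CM_of_kodaira_of_twistedPerfectDoorPrime_of_throughSplitAnchor_of_fieldChartCarriersAll (hC : VHCAbelianSchemesRoad.ChernCharacterOnBetti)
    (hDoor : VHCAbelianSchemesRoad.TwistedPerfectDoorPrime) (hK : Kodaira1954_rationalKaehlerClass_eq_hyperplaneClass) (h : andre1996_weilLineFamily_throughSplitAnchor)
    (hall : ∀ C : ChernCharacterBetti, OneSplitWeilAnchorFieldChartCarriersAll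
      (twistedReflexiveClass C (fun n X₀ I E => gluableSigmaAdmissible n X₀ I E ∨ bfSingleAdmissible' n X₀ I E))) :
    RankFourFaces.CMAbelianHodge := by
  obtain ⟨C⟩ := (hC : Nonempty ChernCharacterBetti)
  exact HC_CM_of_kodaira_of_throughSplitAnchor_of_door_of_oneSplitWeilAnchorFieldChartCarriersAll hK h
    (localVariationalHodgeFor_admTw'_of_twistedPerfectDoorPrime hDoor C) (hall C)

/-- **`HC_AV ⟸ K-C ∧ TwistedPerfectDoorPrime ∧ Kodaira ∧ AndreCMAnchoredPencil ∧ the family fact ∧ (∀ C, CMAlgebraicCarriers (tw C AdmTw′)) ∧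
(∀ C, OneSplitWeilAnchorFieldChartCarriersAll (tw C AdmTw′))`** — THE ANDRÉ COLUMN'S `B_min` OF GEN 64 AT THE ROUTE'S PRIMED DOOR (`HC_CM` IDLE): besides the road's rev-22
binders K-C (19780), the primed door (20706) and Lemme 6.3.1 (19783), Kodaira and ONE André∕Deligne family fact (theorems in print, by name), TWO carrier statements for
`AdmTw′`-admissible `B`-twisted perfect complexes modulo the `θ`-ray — (i) carriers of KNOWN ALGEBRAIC classes (`2 ≤ p`, `2p + 4 ≤ n`) on polarised CM abelian `n`-folds;
(ii) per inhabited type `(E, p)`, `p ≥ 2` — PER FIELD for imaginary quadratic `E` — ONE split anchor of our choice at whose every chart SOME non-zero rational `E`-Weil class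
is carried (the `(ℚ(√−r), 3)` conjuncts of (ii) PREPRINT-SERVED by L1″(C, AdmTw′), §1). [cite: Andre1996Motifs, §6.3 (pp. 31–33)] [cite: Andre1992HodgeCM, Théorème]
[cite: Deligne1982HodgeCycles, §4 proof of Thm. 4.8] [cite: Markman2025SecantWeil, Thm. 1.4.1 and §1.5] [cite: BuchweitzFlenner2003, §5 Thm. 5.1]
[cite: Pridham2024Semiregularity, Cor. 2.25 and Rem. 2.26–2.27] [cite: Bloch1972Semiregularity, Remark (7.5)] -/
theorem HC_AV_of_kodaira_of_twistedPerfectDoorPrime_of_cmAlgebraic_and_fieldChartCarriers (hC : VHCAbelianSchemesRoad.ChernCharacterOnBetti)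
    (hDoor : VHCAbelianSchemesRoad.TwistedPerfectDoorPrime) (hK : Kodaira1954_rationalKaehlerClass_eq_hyperplaneClass)
    (h₂₁ : VHCAbelianSchemesRoad.AndreCMAnchoredPencil) (h : andre1996_weilLineFamily_throughSplitAnchor)
    (hcm : ∀ C : ChernCharacterBetti, CMAlgebraicCarriers
      (twistedReflexiveClass C (fun n X₀ I E => gluableSigmaAdmissible n X₀ I E ∨ bfSingleAdmissible' n X₀ I E)))
    (hall : ∀ C : ChernCharacterBetti, OneSplitWeilAnchorFieldChartCarriersAll
      (twistedReflexiveClass C (fun n X₀ I E => gluableSigmaAdmissible n X₀ I E ∨ bfSingleAdmissible' n X₀ I E))) :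
    PadicSemiregularLift.HodgeAbelianVarieties := by
  obtain ⟨C⟩ := (hC : Nonempty ChernCharacterBetti)
  exact fun A ↦ forall_hodgeConjectureFor_of_kodaira_of_throughSplitAnchor_of_door_of_cmAlgebraic_of_fieldChartCarriersAll h₂₁ hK h
    (localVariationalHodgeFor_admTw'_of_twistedPerfectDoorPrime hDoor C) (hcm C) (hall C) A

/-- **Both axes at once, primed door**: K-C ∧ TwistedPerfectDoorPrime ∧ Kodaira ∧ the family fact ∧ `(∀ C, OneSplitWeilAnchorFieldChartCarriersAll (tw C AdmTw′))` ⟹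
`HC_CM ∧ AndreSplitWeilClasses`. [cite: Andre1996Motifs, §6.3 (pp. 32–33)] [cite: Andre1992HodgeCM, Théorème] [cite: Deligne1982HodgeCycles, §4 proof of Thm. 4.8] -/
theorem HC_CM_and_andreSplitWeilClasses_of_twistedPerfectDoorPrime_of_fieldChartCarriersAll (hC : VHCAbelianSchemesRoad.ChernCharacterOnBetti)
    (hDoor : VHCAbelianSchemesRoad.TwistedPerfectDoorPrime) (hK : Kodaira1954_rationalKaehlerClass_eq_hyperplaneClass) (h : andre1996_weilLineFamily_throughSplitAnchor)
    (hall : ∀ C : ChernCharacterBetti, OneSplitWeilAnchorFieldChartCarriersAll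
      (twistedReflexiveClass C (fun n X₀ I E => gluableSigmaAdmissible n X₀ I E ∨ bfSingleAdmissible' n X₀ I E))) :
    RankFourFaces.CMAbelianHodge ∧ AndreSplitWeilClasses :=
  ⟨HC_CM_of_kodaira_of_twistedPerfectDoorPrime_of_throughSplitAnchor_of_fieldChartCarriersAll hC hDoor hK h hall,
    andreSplitWeilClasses_of_twistedPerfectDoorPrime_of_throughSplitAnchor_of_fieldChartCarriersAll hC hDoor h hall⟩

/-! ## §4 Honest bookkeeping: primed vs unprimed (the primed carrier nodes are the stronger ones, the primed door the weaker one) -/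

/-- `tw C AdmTw′ ⊆ tw C AdmTw` on objects, hence **the field-wise node at the PRIMED door implies the node at the door of record** (carriers must be `AdmTw′`-admissible:
σ-gluable disjunct, or Buchweitz–Flenner data on an initial segment). The converse is NOT claimed. [cite: BuchweitzFlenner2003, §5 Thm. 5.1]
[cite: Pridham2024Semiregularity, Cor. 2.25 and Rem. 2.26] -/
theorem oneSplitWeilAnchorFieldChartCarriersAll_admTw_of_admTw'
    (h : OneSplitWeilAnchorFieldChartCarriersAll (twistedReflexiveClass C (fun n X₀ I E => gluableSigmaAdmissible n X₀ I E ∨ bfSingleAdmissible' n X₀ I E))) :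
    OneSplitWeilAnchorFieldChartCarriersAll (twistedReflexiveClass C (fun n X₀ I E => gluableSigmaAdmissible n X₀ I E ∨ bfSingleAdmissible n X₀ I E)) :=
  h.mono fun _ _ _ _ hκ ↦ twistedReflexiveClass_or_bfSingle_of_or_bfSingle' C hκ

/-- The per-field `(6,3)` cell at the primed door implies the cell at the door of record. The converse is NOT claimed. [cite: BuchweitzFlenner2003, §5 Thm. 5.1] -/
theorem quadraticFieldSplitSixfoldAnchorOneCarrier_admTw_of_admTw'
    (h : QuadraticFieldSplitSixfoldAnchorOneCarrier (twistedReflexiveClass C (fun n X₀ I E => gluableSigmaAdmissible n X₀ I E ∨ bfSingleAdmissible' n X₀ I E))) :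
    QuadraticFieldSplitSixfoldAnchorOneCarrier (twistedReflexiveClass C (fun n X₀ I E => gluableSigmaAdmissible n X₀ I E ∨ bfSingleAdmissible n X₀ I E)) :=
  h.mono fun _ _ _ _ hκ ↦ twistedReflexiveClass_or_bfSingle_of_or_bfSingle' C hκ

/-- **The door of record implies the primed door** (`TwistedPerfectDoor ⟹ TwistedPerfectDoorPrime`: a transfer theorem for the wider object class serves the narrower one,
`TwistedPerfectDoorVHC.anti`). The converse is NOT claimed. [cite: BuchweitzFlenner2003, §5 Thm. 5.1 (binder shape)] -/
theorem twistedPerfectDoorPrime_of_twistedPerfectDoor (hDoor : VHCAbelianSchemesRoad.TwistedPerfectDoor) : VHCAbelianSchemesRoad.TwistedPerfectDoorPrime :=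
  fun C ↦ TwistedPerfectDoorVHC.anti (fun _ _ _ _ h ↦ h.imp_right bfSingleAdmissible_of_prime) (hDoor C)

/-- **The gen-63 typed input at the door of record ⟹ the gen-64 field-wise input there** (typed ⟹ field-wise, `m = 1`), so PART AF's unprimed `B_min` row is recovered from
the door-generic row of `Ring2AbelianAllOneSplitWeilAnchorQuadraticField` §3; recorded as the comparison edge «gen 63 (ii) ⟹ gen 64 (ii)» at `AdmTw`.
[cite: vanGeemen1994HodgeAV, 4.9] [cite: Bloch1972Semiregularity, Remark (7.5)] -/
theorem oneSplitWeilAnchorFieldChartCarriersAll_admTw_of_oneSplitWeilAnchorChartTwistedCarriersAll (h : OneSplitWeilAnchorChartTwistedCarriersAll)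
    (C : ChernCharacterBetti) :
    OneSplitWeilAnchorFieldChartCarriersAll (twistedReflexiveClass C (fun n X₀ I E => gluableSigmaAdmissible n X₀ I E ∨ bfSingleAdmissible n X₀ I E)) :=
  oneSplitWeilAnchorFieldChartCarriersAll_of_oneSplitWeilAnchorChartCarriersAll (oneSplitWeilAnchorChartTwistedCarriersAll_iff_forall.1 h C)

end Summit.HodgeConjecture.HodgeConjecture.Ring2.AbelianAll

end
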